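import Mathlib
import Summits.Ventures.PercRepro2.Defs
import Summits.Ventures.PercRepro2.Harris
import Summits.Ventures.PercRepro2.Graph
import Summits.Ventures.PercRepro2.Events
import Summits.Ventures.PercRepro2.BHKEvents
import Summits.Ventures.PercRepro2.PsiPinInduction
import Summits.Ventures.PercRepro2.PsiUniSure
import Summits.Ventures.PercRepro2.PsiUniExplored
import Summits.Ventures.PercRepro2.PsiTEdge

/-!
# The `o`-exploration edge to `s`: the one-edge connectivity lemmas (PercRepro2, p2)

Adding one edge `f = {x, s}` to a configuration merges the clusters of `x` and `s`: `a ↔ b` in the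
open world iff `a ↔ b` in the closed world or the two ends are joined through `f`
(`conn_update_true_iff_or`).  With `x` in the explored `o`-component (so `x ↔ o` on every
configuration respecting the pins), `s ↔ v` becomes `s ↔ v ∨ o ↔ v` and `y ↔ o` becomes
`y ↔ o ∨ y ↔ s` — the closed-world description of the open world of the `o`-exploration edge to `s`
used by `R21OEdgeS.lean` (P2-G19-YCLUSTER.md §3d).
-/

namespace Summit.Ventures.PercRepro2

section OEdgeGraph

variable {V : Type*} {E : Type*} [DecidableEq E] {R : Type*} [CommRing R] [LinearOrder R]

omit [LinearOrder R] in
/-- **Adding one edge.** With the edge `f = {x, s}` forced open, `a ↔ b` iff `a ↔ b` in the closed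
world or the two ends are joined through `f`. -/
lemma conn_update_true_iff_or {ends : E → Sym2 V} {ω : Config E} {f : E} {x s : V}
    (hf : ends f = s(x, s)) (a b : V) :
    Conn ends (Function.update ω f true) a b ↔
      Conn ends (Function.update ω f false) a b ∨
        (Conn ends (Function.update ω f false) a x ∧ Conn ends (Function.update ω f false) s b) ∨
        (Conn ends (Function.update ω f false) a s ∧ Conn ends (Function.update ω f false) x b) := by
  have hle : Function.update ω f false ≤ Function.update ω f true := update_false_le_update_true ω f
  have hxs : Conn ends (Function.update ω f true) x s := by
    apply conn_of_openAdj
    exact ⟨f, by simp, hf⟩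
  constructor
  · intro h
    have hS : ∀ c ∈ {v | Conn ends (Function.update ω f false) a v ∨
        (Conn ends (Function.update ω f false) a x ∧ Conn ends (Function.update ω f false) s v) ∨
        (Conn ends (Function.update ω f false) a s ∧ Conn ends (Function.update ω f false) x v)},
        ∀ d, (openGraph ends (Function.update ω f true)).Adj c d →
          d ∈ {v | Conn ends (Function.update ω f false) a v ∨
            (Conn ends (Function.update ω f false) a x ∧ Conn ends (Function.update ω f false) s v) ∨
            (Conn ends (Function.update ω f false) a s ∧ Conn ends (Function.update ω f false) x v)} := by
      intro c hc d hcd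
      simp only [Set.mem_setOf_eq] at hc ⊢
      obtain ⟨hne, e, he, hends⟩ := openGraph_adj.1 hcd
      by_cases hef : e = f
      · subst hef
        rw [hf] at hends
        rcases Sym2.eq_iff.1 hends with ⟨rfl, rfl⟩ | ⟨rfl, rfl⟩
        · -- `c = x`, `d = s`
          rcases hc with hc | ⟨hax, _⟩ | ⟨has, hxx⟩
          · exact Or.inr (Or.inl ⟨hc, conn_refl _ _ _⟩)
          · exact Or.inr (Or.inl ⟨hax, conn_refl _ _ _⟩)
          · exact Or.inl has
        · -- `c = s`, `d = x`
          rcases hc with hc | ⟨hax, hss⟩ | ⟨has, hxs'⟩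
          · exact Or.inr (Or.inr ⟨hc, conn_refl _ _ _⟩)
          · exact Or.inl hax
          · exact Or.inr (Or.inr ⟨has, conn_refl _ _ _⟩)
      · rw [Function.update_of_ne hef] at he
        have hadj : (openGraph ends (Function.update ω f false)).Adj c d :=
          openGraph_adj.2 ⟨hne, e, by rw [Function.update_of_ne hef]; exact he, hends⟩
        rcases hc with hc | ⟨hax, hsc⟩ | ⟨has, hxc⟩
        · exact Or.inl (conn_trans hc (SimpleGraph.Adj.reachable hadj))
        · exact Or.inr (Or.inl ⟨hax, conn_trans hsc (SimpleGraph.Adj.reachable hadj)⟩)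
        · exact Or.inr (Or.inr ⟨has, conn_trans hxc (SimpleGraph.Adj.reachable hadj)⟩)
    exact mem_of_conn_of_closed hS (Or.inl (conn_refl _ _ _)) h
  · rintro (h | ⟨hax, hsb⟩ | ⟨has, hxb⟩)
    · exact conn_mono hle h
    · exact conn_trans (conn_mono hle hax) (conn_trans hxs (conn_mono hle hsb))
    · exact conn_trans (conn_mono hle has) (conn_trans (conn_symm hxs) (conn_mono hle hxb))

/-- On a configuration respecting the pins off `f`, with `x` in the explored `o`-component,
`x ↔ v` iff `o ↔ v` in the closed world. -/
lemma conn_x_iff_o {ends : E → Sym2 V} {p : E → R} {ω : Config E} {f : E} {x o : V}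
    (hx : Conn ends (fun e => decide (p e = 1)) o x) (hpf : p f ≠ 1)
    (h1 : ∀ e, e ≠ f → p e = 1 → ω e = true) (v : V) :
    Conn ends (Function.update ω f false) x v ↔ Conn ends (Function.update ω f false) o v := by
  have hle : (fun e => decide (p e = 1)) ≤ Function.update ω f false := by
    refine pinned_le_of_respects_off hpf fun e he hpe => ?_
    rw [Function.update_of_ne he]; exact h1 e he hpe
  have hox : Conn ends (Function.update ω f false) o x := conn_mono hle hx
  exact ⟨fun h => conn_trans hox h, fun h => conn_trans (conn_symm hox) h⟩

/-- With `f = {x, s}` open and `x` in the explored `o`-component, `s ↔ v` iff `s ↔ v` or `o ↔ v` in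
the closed world. -/
lemma conn_update_true_s_iff_or_o {ends : E → Sym2 V} {p : E → R} {ω : Config E} {f : E} {x s o : V}
    (hf : ends f = s(x, s)) (hx : Conn ends (fun e => decide (p e = 1)) o x)
    (hpf : p f ≠ 1) (h1 : ∀ e, e ≠ f → p e = 1 → ω e = true) (v : V) :
    Conn ends (Function.update ω f true) s v ↔
      Conn ends (Function.update ω f false) s v ∨ Conn ends (Function.update ω f false) o v := by
  rw [conn_update_true_iff_or hf, conn_x_iff_o hx hpf h1]
  constructor
  · rintro (h | ⟨_, h⟩ | ⟨_, h⟩)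
    · exact Or.inl h
    · exact Or.inl h
    · exact Or.inr h
  · rintro (h | h)
    · exact Or.inl h
    · exact Or.inr (Or.inr ⟨conn_refl _ _ _, h⟩)

/-- With `f = {x, s}` open and `x` in the explored `o`-component, `y ↔ o` iff `y ↔ o` or `y ↔ s`
in the closed world. -/
lemma conn_update_true_y_o_iff {ends : E → Sym2 V} {p : E → R} {ω : Config E} {f : E} {x s o y : V}
    (hf : ends f = s(x, s)) (hx : Conn ends (fun e => decide (p e = 1)) o x)
    (hpf : p f ≠ 1) (h1 : ∀ e, e ≠ f → p e = 1 → ω e = true) :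
    Conn ends (Function.update ω f true) y o ↔
      Conn ends (Function.update ω f false) y o ∨ Conn ends (Function.update ω f false) y s := by
  rw [conn_update_true_iff_or hf]
  have hxo : Conn ends (Function.update ω f false) x o := (conn_x_iff_o hx hpf h1 o).2 (conn_refl _ _ _)
  constructor
  · rintro (h | ⟨hyx, _⟩ | ⟨hys, _⟩)
    · exact Or.inl h
    · exact Or.inl (conn_trans hyx hxo)
    · exact Or.inr hys
  · rintro (h | h)
    · exact Or.inl h
    · exact Or.inr (Or.inr ⟨h, hxo⟩)

end OEdgeGraph

end Summit.Ventures.PercRepro2
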